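import Summits.MatrixMultiplication.MatrixMultiplication.Theorems.OutsiderSandwichLevelRateThree
import HarnessLib

/-!
# Simultaneous generic rank, and the full core bound `n²` from Flanders' theorem

Route `OutsiderSandwich` (decomposition cell `decomp-mm`, lens 4 «minimal counterexample /
extremal reduction», gen 28, addendum), support for the aside leaf `BlockOneIsMM`
(stmt-MatrixMultiplication-27147).  This file isolates the single literature input standing
between the rate ladder `1 + 2^{-N}` (`OutsiderSandwichLevelRateThree`) and the ceiling of the
core-bound method, the level-independent law `3m ≤ 2B`:

**Flanders' theorem** (1962; Meshulam 1985 for all fields): a linear subspace of `M_n` all of whose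
elements have rank `≤ r` has dimension `≤ r·n`.  It enters only as the hypothesis `hF` of the two
final theorems; everything else is proved here.

* `rank_add_rank_le` — `X·Y = 0 ⟹ rank X + rank Y ≤ n`.
* `exists_finset_rank_le` — **generic rank, determinant-free**: off a finite set of `t`,
  `rank (A + t·B) ≥ rank A` (a left inverse of `A` on a complement of `ker A` turns the kernel
  equation into an eigen-equation for one endomorphism, whose spectrum is finite).
* `exists_simultaneous` — in a space of pairs some element attains the maximal rank in both
  components at once (`ℂ` is infinite).
* `pairRank_le_sq_of_flanders` — **full core bound**: Flanders' theorem implies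
  `dim π₁L + dim π₂L ≤ n²` for every space `L` of pairs with `V·Y = 0` on `L`
  (generic pair `(X, Y)`: `rank X + rank Y ≤ n`, then Flanders on each projection).
* `rate_law_of_flanders` — hence `Amortised N B m ⟹ 3m ≤ 2B` at every level `N ≥ 1`, i.e. the
  amortised number would be `a(N, m) = ⌈3m/2⌉`-bounded below exactly as at level one
  (`OutsiderSandwichLevelOne`), the ceiling of the method recorded in the cell memo.

## References
* P. Bürgisser, M. Clausen, M. A. Shokrollahi, *Algebraic Complexity Theory*, Springer (1997),
  §17.1. [BurgisserClausenShokrollahi1997]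
* D. Coppersmith, S. Winograd, *Matrix multiplication via arithmetic progressions*,
  J. Symbolic Comput. 9 (1990) 251–280, §7. [CoppersmithWinograd1990]
-/

noncomputable section
open scoped BigOperators Matrix
set_option linter.dupNamespace false
set_option autoImplicit false

namespace Summit.MatrixMultiplication.MatrixMultiplication.Theorems.OutsiderSandwichGenericRank

open Literature.Computability.AlgebraicComplexity
open Summit.MatrixMultiplication.MatrixMultiplication.Theorems.OutsiderSandwichAmortised
open Summit.MatrixMultiplication.MatrixMultiplication.Theorems.OutsiderSandwichAmortisedTable
open Summit.MatrixMultiplication.MatrixMultiplication.Theorems.OutsiderSandwichLevelLaw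

section Rank

variable {ρ : Type} [Fintype ρ] [DecidableEq ρ]

/-! ## 1. Rank bookkeeping -/

omit [DecidableEq ρ] in
/-- `X·Y = 0 ⟹ rank X + rank Y ≤ n`. [folklore] -/
theorem rank_add_rank_le (X Y : Matrix ρ ρ ℂ) (h : X * Y = 0) :
    X.rank + Y.rank ≤ Fintype.card ρ := by
  have hker : LinearMap.range Y.mulVecLin ≤ LinearMap.ker X.mulVecLin := by
    rintro _ ⟨v, rfl⟩
    rw [LinearMap.mem_ker]
    show X *ᵥ (Y *ᵥ v) = 0
    rw [Matrix.mulVec_mulVec, h, Matrix.zero_mulVec]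
  have e := LinearMap.finrank_range_add_finrank_ker X.mulVecLin
  rw [Module.finrank_fintype_fun_eq_card] at e
  have := Submodule.finrank_mono hker
  unfold Matrix.rank
  omega

/-- `rank (c • M) ≤ rank M`. [folklore] -/
theorem rank_smul_le (c : ℂ) (M : Matrix ρ ρ ℂ) : (c • M).rank ≤ M.rank := by
  have e : c • M = (c • (1 : Matrix ρ ρ ℂ)) * M := by rw [smul_mul_assoc, one_mul]
  rw [e]
  exact Matrix.rank_mul_le_right _ _

omit [DecidableEq ρ] in
/-- A set of matrices has an element of maximal rank. [folklore] -/
theorem exists_max_rank (S : Set (Matrix ρ ρ ℂ)) (hS : S.Nonempty) :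
    ∃ x ∈ S, ∀ y ∈ S, y.rank ≤ x.rank := by
  classical
  have hb : ∀ y ∈ S, y.rank ∈ Finset.range (Fintype.card ρ + 1) := fun y _ =>
    Finset.mem_range.2 (Nat.lt_succ_of_le (Matrix.rank_le_card_width y))
  let T := (Finset.range (Fintype.card ρ + 1)).filter fun k => ∃ y ∈ S, y.rank = k
  obtain ⟨x₀, hx₀⟩ := hS
  have hT : T.Nonempty := ⟨_, Finset.mem_filter.2 ⟨hb _ hx₀, _, hx₀, rfl⟩⟩
  obtain ⟨y, hy, hk⟩ := (Finset.mem_filter.1 (Finset.max'_mem T hT)).2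
  refine ⟨y, hy, fun z hz => ?_⟩
  rw [hk]
  exact Finset.le_max' T _ (Finset.mem_filter.2 ⟨hb z hz, z, hz, rfl⟩)

/-! ## 2. Generic rank, determinant-free -/

omit [DecidableEq ρ] in
/-- **Generic rank.**  Off a finite set of parameters, `rank (A + t·B) ≥ rank A`. [folklore] -/
theorem exists_finset_rank_le (A B : Matrix ρ ρ ℂ) :
    ∃ F : Finset ℂ, ∀ t : ℂ, t ∉ F → A.rank ≤ (A + t • B).rank := by
  classical
  obtain ⟨U, hU⟩ := Submodule.exists_isCompl (LinearMap.ker A.mulVecLin)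
  let f : U →ₗ[ℂ] (ρ → ℂ) := A.mulVecLin ∘ₗ U.subtype
  have hf : LinearMap.ker f = ⊥ := by
    rw [eq_bot_iff]
    intro u hu
    rw [LinearMap.mem_ker] at hu
    have h1 : (u : ρ → ℂ) ∈ LinearMap.ker A.mulVecLin ⊓ U := ⟨hu, u.2⟩
    rw [hU.inf_eq_bot, Submodule.mem_bot] at h1
    exact (Submodule.mem_bot ℂ).2 (Subtype.ext h1)
  obtain ⟨ℓ, hℓ⟩ := LinearMap.exists_leftInverse_of_injective f hf
  let C : Module.End ℂ U := ℓ ∘ₗ (B.mulVecLin ∘ₗ U.subtype)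
  have hfin := (Module.End.finite_spectrum C).image fun μ : ℂ => -μ⁻¹
  refine ⟨hfin.toFinset, fun t ht => ?_⟩
  -- `(A + tB)` is injective on `U`
  have hinj : Function.Injective ((A + t • B).mulVecLin ∘ₗ U.subtype) := by
    rw [← LinearMap.ker_eq_bot, eq_bot_iff]
    intro w hw
    rw [LinearMap.mem_ker] at hw
    have hw' : f w + t • B.mulVecLin (w : ρ → ℂ) = 0 := by
      have e : ((A + t • B).mulVecLin ∘ₗ U.subtype) w = (A + t • B) *ᵥ (w : ρ → ℂ) := rfl
      rw [e, Matrix.add_mulVec, Matrix.smul_mulVec] at hw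
      exact hw
    have hw'' : w + t • C w = 0 := by
      have e := congrArg ℓ hw'
      rw [map_add, map_smul, map_zero] at e
      have e1 : ℓ (f w) = w := LinearMap.ext_iff.1 hℓ w
      rw [e1] at e
      exact e
    by_cases ht0 : t = 0
    · rw [ht0, zero_smul, add_zero] at hw''
      rw [hw'']
      exact Submodule.zero_mem _
    · have hμ : -t⁻¹ ∉ spectrum ℂ C := by
        intro hmem
        apply ht
        rw [Set.Finite.mem_toFinset]
        refine ⟨-t⁻¹, hmem, ?_⟩
        show -(-t⁻¹)⁻¹ = t
        rw [inv_neg, inv_inv, neg_neg]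
      rw [spectrum.mem_iff, not_not] at hμ
      have hbij := (Module.End.isUnit_iff _).1 hμ
      have hCw : C w = (-t⁻¹) • w := by
        have e1 : t • C w = -w := eq_neg_of_add_eq_zero_right hw''
        have e2 : C w = t⁻¹ • (t • C w) := by
          rw [smul_smul, inv_mul_cancel₀ ht0, one_smul]
        rw [e2, e1, smul_neg]
        exact (neg_smul t⁻¹ w).symm
      have hz : (algebraMap ℂ (Module.End ℂ U) (-t⁻¹) - C) w = 0 := by
        rw [LinearMap.sub_apply, Module.algebraMap_end_apply, hCw, sub_self]
      have hw0 : w = 0 := hbij.1 (by rw [hz, map_zero])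
      rw [hw0]
      exact Submodule.zero_mem _
  -- dimension count
  have h1 := LinearMap.finrank_range_of_inj hinj
  have h2 : Module.finrank ℂ
      (LinearMap.range ((A + t • B).mulVecLin ∘ₗ U.subtype)) ≤ (A + t • B).rank :=
    Submodule.finrank_mono (LinearMap.range_comp_le_range _ _)
  have h3 := Submodule.finrank_add_eq_of_isCompl hU
  have h4 := LinearMap.finrank_range_add_finrank_ker A.mulVecLin
  rw [Module.finrank_fintype_fun_eq_card] at h3 h4
  unfold Matrix.rank at h2 ⊢
  omega

/-- **Simultaneous generic rank.**  Some `x₁ + t·x₂` has first component of rank `≥ rank x₁.1`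
and second component of rank `≥ rank x₂.2`. [folklore] -/
theorem exists_simultaneous (x₁ x₂ : Matrix ρ ρ ℂ × Matrix ρ ρ ℂ) :
    ∃ t : ℂ, x₁.1.rank ≤ (x₁.1 + t • x₂.1).rank ∧ x₂.2.rank ≤ (x₁.2 + t • x₂.2).rank := by
  classical
  obtain ⟨F₁, hF₁⟩ := exists_finset_rank_le x₁.1 x₂.1
  obtain ⟨F₂, hF₂⟩ := exists_finset_rank_le x₂.2 x₁.2
  obtain ⟨t, ht⟩ := Infinite.exists_notMem_finset (F₁ ∪ F₂.image (fun s => s⁻¹) ∪ {0})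
  simp only [Finset.mem_union, Finset.mem_image, Finset.mem_singleton, not_or,
    not_exists, not_and] at ht
  obtain ⟨⟨ht₁, ht₂⟩, ht0⟩ := ht
  refine ⟨t, hF₁ t ht₁, ?_⟩
  have hs : t⁻¹ ∉ F₂ := fun h => ht₂ _ h (inv_inv t)
  have h := hF₂ t⁻¹ hs
  have e : x₂.2 + t⁻¹ • x₁.2 = t⁻¹ • (x₁.2 + t • x₂.2) := by
    rw [smul_add, smul_smul, inv_mul_cancel₀ ht0, one_smul, add_comm]
  rw [e] at h
  exact h.trans (rank_smul_le _ _)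

/-! ## 3. The full core bound from Flanders' theorem -/

/-- **Full core bound, conditional.**  If every subspace of `M_n(ℂ)` of rank `≤ r` has
dimension `≤ r·n` (Flanders 1962), then a space `L` of pairs with `V·Y = 0` on `L` has
`dim π₁L + dim π₂L ≤ n²`. [cite: BurgisserClausenShokrollahi1997, §17.1] -/
theorem pairRank_le_sq_of_flanders
    (hF : ∀ (r : ℕ) (P : Submodule ℂ (Matrix ρ ρ ℂ)), (∀ X ∈ P, X.rank ≤ r) →
      Module.finrank ℂ P ≤ r * Fintype.card ρ)
    (L : Submodule ℂ (Matrix ρ ρ ℂ × Matrix ρ ρ ℂ)) (hL : ∀ x ∈ L, x.1 * x.2 = 0) :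
    pairRank ρ L ≤ Fintype.card ρ ^ 2 := by
  obtain ⟨X₁, ⟨x₁, hx₁, rfl⟩, hmax₁⟩ :=
    exists_max_rank (Prod.fst '' (L : Set (Matrix ρ ρ ℂ × Matrix ρ ρ ℂ))) ⟨_, 0, L.zero_mem, rfl⟩
  obtain ⟨Y₂, ⟨x₂, hx₂, rfl⟩, hmax₂⟩ :=
    exists_max_rank (Prod.snd '' (L : Set (Matrix ρ ρ ℂ × Matrix ρ ρ ℂ))) ⟨_, 0, L.zero_mem, rfl⟩
  obtain ⟨t, ht₁, ht₂⟩ := exists_simultaneous x₁ x₂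
  have hz : x₁ + t • x₂ ∈ L := L.add_mem hx₁ (L.smul_mem t hx₂)
  have hsum := rank_add_rank_le _ _ (hL _ hz)
  rw [Prod.fst_add, Prod.snd_add, Prod.smul_fst, Prod.smul_snd] at hsum
  have hP := hF x₁.1.rank (L.map (LinearMap.fst ℂ (Matrix ρ ρ ℂ) (Matrix ρ ρ ℂ)))
    fun X hX => by
      obtain ⟨y, hy, rfl⟩ := Submodule.mem_map.1 hX
      exact hmax₁ _ ⟨y, hy, rfl⟩
  have hQ := hF x₂.2.rank (L.map (LinearMap.snd ℂ (Matrix ρ ρ ℂ) (Matrix ρ ρ ℂ)))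
    fun Y hY => by
      obtain ⟨y, hy, rfl⟩ := Submodule.mem_map.1 hY
      exact hmax₂ _ ⟨y, hy, rfl⟩
  have hrs : (x₁.1.rank + x₂.2.rank) * Fintype.card ρ ≤ Fintype.card ρ * Fintype.card ρ :=
    Nat.mul_le_mul_right _ (by omega)
  unfold pairRank
  rw [sq]
  have e : (x₁.1.rank + x₂.2.rank) * Fintype.card ρ =
      x₁.1.rank * Fintype.card ρ + x₂.2.rank * Fintype.card ρ := add_mul _ _ _
  omega

end Rank

/-! ## 4. The ceiling of the method: `3m ≤ 2B` at every level, given Flanders -/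

/-- **Rate law at the ceiling, conditional on Flanders' theorem at format `2^N`**:
`Amortised N B m ⟹ 3m ≤ 2B` (`N ≥ 1`). [cite: CoppersmithWinograd1990, §7] -/
theorem rate_law_of_flanders {N B m : ℕ} (hN : 1 ≤ N)
    (hF : ∀ (r : ℕ) (P : Submodule ℂ (Matrix (Fin N → Fin 2) (Fin N → Fin 2) ℂ)),
      (∀ X ∈ P, X.rank ≤ r) → Module.finrank ℂ P ≤ r * Fintype.card (Fin N → Fin 2))
    (h : Amortised N B m) : 3 * m ≤ 2 * B := by
  have hcard : Fintype.card (Fin N → Fin 2) = 2 ^ N := by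
    simp only [Fintype.card_fun, Fintype.card_fin]
  have h4 : Fintype.card (Fin N → Fin 2) ^ 2 = 4 ^ N := by
    rw [hcard, ← pow_mul, mul_comm, pow_mul]; norm_num
  have key := level_law hN (Equiv.refl _)
    (fun L hL => (pairRank_le_sq_of_flanders hF L hL).trans_eq h4) h
  have hK : 0 < 4 ^ N := by positivity
  refine Nat.le_of_mul_le_mul_right (c := 4 ^ N) ?_ hK
  have l1 : 3 * m * 4 ^ N = 4 * m * 4 ^ N - m * 4 ^ N := by
    rw [show 4 * m * 4 ^ N = 3 * m * 4 ^ N + m * 4 ^ N by ring, Nat.add_sub_cancel]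
  rw [l1]
  have l2 : 2 * B * 4 ^ N = 2 * B * 4 ^ N := rfl
  omega

/-- Hence `3m ≤ 2·a(N, m)` at every level, given Flanders' theorem at format `2^N`.
[cite: CoppersmithWinograd1990, §7] -/
theorem amortisedNumber_of_flanders {N : ℕ} (hN : 1 ≤ N)
    (hF : ∀ (r : ℕ) (P : Submodule ℂ (Matrix (Fin N → Fin 2) (Fin N → Fin 2) ℂ)),
      (∀ X ∈ P, X.rank ≤ r) → Module.finrank ℂ P ≤ r * Fintype.card (Fin N → Fin 2))
    (m : ℕ) : 3 * m ≤ 2 * amortisedNumber N m :=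
  rate_law_of_flanders hN hF (amortised_amortisedNumber N m)

end Summit.MatrixMultiplication.MatrixMultiplication.Theorems.OutsiderSandwichGenericRank
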